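import Summits.QuantumFields.QCD.Theses.HeatSlicedQuarks

/-!
# `RobustYangMillsHandover` — load-bearing analysis of its antecedent (negative lane)

Crux `stmt-QuantumFields-8892` of route `HeatSlicedQuarks` is the bare implication
`RobustYangMillsHandover := ContinuumQCDExists → QCD`.  This file records, kernel-checked, which
part of the antecedent X₀ = `ContinuumQCDExists` a proof can actually lean on: X₀ with its three
non-triviality clauses (`IsNontrivial glue`, `IsNonGaussian glue`, `IsNontrivial (pseudoRe f g)`)
dropped HOLDS OUTRIGHT on junk data (regularisation `canonicalAF`, species renormalisations
`z = shift = 0`, vacuum OS data; `continuumQCDExists_withoutNontriviality_holds`), so the handover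
weakened to accept such data is EQUIVALENT to the summit conjunct `QCD`
(`handover_withoutNontriviality_iff_qcd`) — refuted by nothing and proved by nothing short of it.
Consequence for provers: the regularisation data, `HasMassScaling`, asymptotic scaling, the
physical-branch mass condition and the convergence of all lattice `n`-point functions handed over by
X₀ are jointly satisfiable by the vacuum; only the non-triviality of the handed-over `T` carries
information.  (cdisprove seat refuter-cdisprove-stmt-QuantumFields-8892-0, 2026-08-16; companion of
`Cruxes/RobustYangMillsHandover/Disproof.lean`.)
-/

namespace Summit.QuantumFields.QCD.Theorems.RobustYangMillsHandover.Negative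

open Summit.QuantumFields.QCD.Theses.HeatSlicedQuarks
open Literature.MathematicalPhysics.QuantumFieldTheory
open Literature.MathematicalPhysics.AQFT
open Filter Topology

/-- With `z ≡ 0` every lattice `n`-point function (`n ≥ 1`) of any scheme vanishes identically
(all smeared insertions are `0`). [folklore] -/
theorem qcdLatticeSchwinger_eq_zero_of_z_eq_zero {Nf : ℕ} (sch : QCDScheme Nf) (hz : sch.z = 0)
    (k n : ℕ) (hn : n ≠ 0) (σ : Fin n → QCDField Nf)
    (f : Fin n → SchwartzMap (EuclideanSpace ℝ (Fin 4)) ℝ) :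
    qcdLatticeSchwinger sch k n σ f = 0 := by
  obtain ⟨j, rfl⟩ := Nat.exists_eq_succ_of_ne_zero hn
  simp [qcdLatticeSchwinger, smearedInsertion, List.ofFn_succ, hz]

/-- **Junk inhabitant of `IsQCDAlong` along ANY regularisation.** If the couplings of `reg` scale
asymptotically and `m_crit(k) ≥ −1` eventually, then for every positive mass tuple the scheme
`reg.scheme m 0 0` (species renormalisations `z = shift = 0`) with the VACUUM OS data satisfies
`IsQCDAlong` (all lattice `n`-point functions vanish, the bare masses `m_crit(k) + a_k m_f / Z_m(k)`
exceed `−1`). Generalises the tree's `isQCDAlong_zeroAF_vacuum`. [folklore] -/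
theorem isQCDAlong_scheme_zero_vacuum {Nf : ℕ} (reg : QCDRegularisation Nf)
    (hβ : (reg.scheme 0 0 0).HasAsymptoticScaling) (hcrit : ∀ᶠ k in atTop, -1 ≤ reg.mcrit k)
    (m : Fin Nf → ℝ) (hm : ∀ f, 0 < m f) :
    IsQCDAlong (reg.scheme m 0 0) (OSData.vacuum (QCDField Nf) 4) := by
  refine ⟨?_, fun fl => ?_, fun n hn σ f F _ _ => ?_⟩
  · obtain ⟨Λ, hΛ, h⟩ := hβ
    exact ⟨Λ, hΛ, h⟩
  · filter_upwards [hcrit] with k hk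
    have hpos : 0 < reg.a k * m fl / reg.Zm k :=
      div_pos (mul_pos (reg.a_pos k) (hm fl)) (reg.Zm_pos k)
    rw [QCDRegularisation.scheme_mq]
    linarith
  · have hS : (OSData.vacuum (QCDField Nf) 4).schwinger n σ F = 0 := by
      simp [OSData.vacuum, LabelledSchwingerFamily.trivial_of_ne_zero (QCDField Nf) hn]
    rw [hS]
    refine tendsto_const_nhds.congr' (Eventually.of_forall fun k => ?_)
    exact (qcdLatticeSchwinger_eq_zero_of_z_eq_zero (reg.scheme m 0 0) rfl k n hn σ f).symm

/-- `canonicalAF.scheme m z shift` scales asymptotically: its `β_k` is the two-loop profile at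
`Λ = 1`. [folklore] -/
theorem hasAsymptoticScaling_canonicalAF_scheme (Nf : ℕ) (m : Fin Nf → ℝ)
    (z shift : QCDField Nf → ℕ → ℝ) :
    ((QCDRegularisation.canonicalAF Nf).scheme m z shift).HasAsymptoticScaling :=
  ⟨1, one_pos, by
    simp [QCDRegularisation.scheme, QCDRegularisation.canonicalAF, QCDScheme.zeroAF]⟩

/-- **X₀ minus non-triviality holds.** `ContinuumQCDExists` with its three non-triviality
clauses (`IsNontrivial glue`, `IsNonGaussian glue`, `IsNontrivial (pseudoRe f g)`) DROPPED —
regularisation with `HasMassScaling`, and for every positive mass tuple some species renormalisations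
and OS data with `IsQCDAlong` — is TRUE on junk data (`canonicalAF`, `z = shift = 0`, vacuum).
[folklore] -/
theorem continuumQCDExists_withoutNontriviality_holds :
    (∀ Nf : ℕ, Nf = 2 ∨ Nf = 3 → ∃ reg : QCDRegularisation Nf, reg.HasMassScaling ∧
      ∀ m : Fin Nf → ℝ, (∀ f, 0 < m f) →
        ∃ (z shift : QCDField Nf → ℕ → ℝ) (T : OSData (QCDField Nf) 4),
          IsQCDAlong (reg.scheme m z shift) T) := by
  intro Nf _
  refine ⟨QCDRegularisation.canonicalAF Nf, QCDRegularisation.canonicalAF_hasMassScaling,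
    fun m hm => ⟨0, 0, OSData.vacuum (QCDField Nf) 4, ?_⟩⟩
  exact isQCDAlong_scheme_zero_vacuum _ (hasAsymptoticScaling_canonicalAF_scheme Nf 0 0 0)
    (Eventually.of_forall fun k => by simp [QCDRegularisation.canonicalAF]) m hm

/-- … and the junk witness is NOT a witness of X₀ itself: the vacuum fails `IsNontrivial glue`
(tree `OSData.not_isNontrivial_vacuum`), which is why the crux does not collapse. [folklore] -/
theorem vacuum_not_isNontrivial_glue (Nf : ℕ) :
    ¬ (OSData.vacuum (QCDField Nf) 4).IsNontrivial QCDField.glue :=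
  OSData.not_isNontrivial_vacuum _

/-- **Load-bearing theorem for `RobustYangMillsHandover`.** The handover with the non-triviality
clauses of its antecedent dropped is EQUIVALENT to the summit conjunct: a proof of the crux that does
not use `IsNontrivial glue` / `IsNonGaussian glue` / `IsNontrivial (pseudoRe f g)` of the handed-over
data is a proof of `QCD` from nothing. (Equivalence with an open statement — no verdict.) [folklore] -/
theorem handover_withoutNontriviality_iff_qcd :
    ((∀ Nf : ℕ, Nf = 2 ∨ Nf = 3 → ∃ reg : QCDRegularisation Nf, reg.HasMassScaling ∧
      ∀ m : Fin Nf → ℝ, (∀ f, 0 < m f) →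
        ∃ (z shift : QCDField Nf → ℕ → ℝ) (T : OSData (QCDField Nf) 4),
          IsQCDAlong (reg.scheme m z shift) T) → _root_.QCD) ↔ _root_.QCD :=
  ⟨fun h => h continuumQCDExists_withoutNontriviality_holds, fun q _ => q⟩

end Summit.QuantumFields.QCD.Theorems.RobustYangMillsHandover.Negative
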